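import Summits.CriticalPhenomena.PercolationContinuityZ3.Theorems.PercNearOneGluingNoHeavyLowerTailNineTypeParity

/-!
# Nine-type programme for `Q44b`: the FLIP LEMMA (complementing every representative preserves dependencies)

Support file for crux `stmt-CriticalPhenomena-4575` (master-family programme, quadratic four-point row `Q44b`,
GF(2)-rank line of `prim-bnk-1` gen 16–17 / `prim-l12-p6` gen 9–10), seat `prim-l12-p1` gen 8; memo
`run/shared/lean/prim/prim-l12/FROM-prim-l12-p1-g8-ANTIPODAL-INTERSECTING.md` §2.

Setting (as in `…NineTypeAnchor`, `…NineTypeParity`): a finite ground type `α`, an UP-SET `𝔊` of "goods",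
and a finite family `𝒮` of "representatives" `ρ ⊆ α` (a bad point `t` taken with sign H contributes `ρ = t`, with
sign L it contributes `ρ = tᶜ`).  The family is a GF(2)-DEPENDENCY of the inclusion rows `([ρ ⊆ g])_{g ∈ 𝔊}` iff
every good contains an even number of members of `𝒮`.

**Flip lemma** (`NineType.flip_even`).  If every good `g ∈ 𝔊` contains an even number of members of `𝒮`, then
every good contains an even number of COMPLEMENTS of members of `𝒮`:
`(∀ g ∈ 𝔊, #{ρ ∈ 𝒮 : ρ ⊆ g} even) → (∀ g ∈ 𝔊, #{ρ ∈ 𝒮 : ρᶜ ⊆ g} even)`.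
Proof: double count `Σ_{u ∈ 𝔊, u ⊇ g} #{ρ ∈ 𝒮 : ρ ⊆ u}` — termwise even by hypothesis (every `u ⊇ g` is good),
and equal to `Σ_{ρ ∈ 𝒮} #{u ∈ 𝔊 : u ⊇ g ∪ ρ} ≡ #{ρ : g ∪ ρ = univ}` by the toggling lemma
(`NineType.card_supersets_even`: a good set other than `univ` has an even number of goods above it).

Consequences (memo §2; no new definitions here): the simultaneous sign flip `v_t ↔ w_t` of ALL points is an
automorphism of the row matroid (`flip_even_iff`); every "all-H" independence theorem (anchor lemma, types
`1–7`) has an "all-L" twin for free; and `w_t = Z v_t` for the zeta matrix `Z` of the poset `𝔊` (`Z² = 1` over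
GF(2), the parity-lemma involution of `prim-l12-p2` gen 17), so Conjecture R reads
`dim (V ∩ Z V) ≤ dim V − d` (`V` = span of the H-rows, `d` = number of independent H-dependencies).

Pure finite combinatorics; theorems only (no definitions, no named facts, no sorries), standard axioms.
-/

namespace Summit.CriticalPhenomena.PercolationContinuityZ3.Theorems

namespace NineType

open Finset

variable {α : Type*} [DecidableEq α] [Fintype α]

/-- In an up-set `𝔊`, the number of goods above a GOOD set `s` is odd iff `s = univ` (toggling lemma
`card_supersets_even` off `univ`; above `univ` there is exactly `univ`). [this work] -/
theorem card_supersets_parity (𝔊 : Finset (Finset α))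
    (hG : ∀ g ∈ 𝔊, ∀ g' : Finset α, g ⊆ g' → g' ∈ 𝔊)
    (s : Finset α) (hs : s ∈ 𝔊) :
    ((#(𝔊.filter (fun u => s ⊆ u)) : ℕ) : ZMod 2) = if s = univ then 1 else 0 := by
  by_cases h : s = univ
  · subst h
    rw [if_pos rfl]
    have hfilt : 𝔊.filter (fun u => (univ : Finset α) ⊆ u) = {univ} := by
      ext u
      simp only [Finset.mem_filter, Finset.mem_singleton, Finset.univ_subset_iff]
      constructor
      · rintro ⟨_, hu⟩; exact hu
      · rintro rfl; exact ⟨hs, rfl⟩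
    rw [hfilt, Finset.card_singleton, Nat.cast_one]
  · rw [if_neg h]
    have hx : ∃ x, x ∉ s := by
      by_contra hall
      exact h (Finset.eq_univ_iff_forall.2 fun x => by
        by_contra hxs
        exact hall ⟨x, hxs⟩)
    obtain ⟨x, hx⟩ := hx
    exact card_supersets_even 𝔊 hG s hs x hx

omit [DecidableEq α] in
/-- `g ∪ ρ = univ ↔ ρᶜ ⊆ g`. [folklore] -/
theorem union_eq_univ_iff_compl_subset [DecidableEq α] (g ρ : Finset α) :
    g ∪ ρ = univ ↔ ρᶜ ⊆ g := by
  constructor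
  · intro h x hx
    rw [Finset.mem_compl] at hx
    have hxu : x ∈ g ∪ ρ := h ▸ Finset.mem_univ x
    rcases Finset.mem_union.1 hxu with hg | hρ
    · exact hg
    · exact absurd hρ hx
  · intro h
    refine Finset.eq_univ_iff_forall.2 fun x => ?_
    by_cases hxρ : x ∈ ρ
    · exact Finset.mem_union.2 (Or.inr hxρ)
    · exact Finset.mem_union.2 (Or.inl (h (Finset.mem_compl.2 hxρ)))

/-- **Flip lemma.**  For an up-set `𝔊` and any finite family `𝒮` of subsets: if every good contains an even
number of members of `𝒮`, then every good contains an even number of complements of members of `𝒮`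
(in `ZMod 2`: `#{ρ ∈ 𝒮 : ρ ⊆ g} = 0` for all `g ∈ 𝔊` implies `#{ρ ∈ 𝒮 : ρᶜ ⊆ g} = 0` for all `g ∈ 𝔊`).
Equivalently: complementing EVERY representative maps GF(2)-dependencies of the inclusion rows over `𝔊` to
dependencies. [this work] -/
theorem flip_even (𝔊 : Finset (Finset α))
    (hG : ∀ g ∈ 𝔊, ∀ g' : Finset α, g ⊆ g' → g' ∈ 𝔊)
    (𝒮 : Finset (Finset α))
    (hdep : ∀ g ∈ 𝔊, ((#(𝒮.filter (fun ρ => ρ ⊆ g)) : ℕ) : ZMod 2) = 0) :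
    ∀ g ∈ 𝔊, ((#(𝒮.filter (fun ρ => ρᶜ ⊆ g)) : ℕ) : ZMod 2) = 0 := by
  intro g hg
  -- the double count `D = Σ_{u ∈ 𝔊, g ⊆ u} #{ρ ∈ 𝒮 : ρ ⊆ u}` vanishes termwise
  have h1 : ∑ u ∈ 𝔊.filter (fun u => g ⊆ u),
      ((#(𝒮.filter (fun ρ => ρ ⊆ u)) : ℕ) : ZMod 2) = 0 :=
    Finset.sum_eq_zero fun u hu => hdep u (Finset.mem_filter.1 hu).1
  -- and equals `Σ_{ρ ∈ 𝒮} #{u ∈ 𝔊 : g ∪ ρ ⊆ u}` after swapping the sums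
  have h2 : ∑ u ∈ 𝔊.filter (fun u => g ⊆ u),
      ((#(𝒮.filter (fun ρ => ρ ⊆ u)) : ℕ) : ZMod 2) =
      ∑ ρ ∈ 𝒮, ((#(𝔊.filter (fun u => g ∪ ρ ⊆ u)) : ℕ) : ZMod 2) := by
    calc ∑ u ∈ 𝔊.filter (fun u => g ⊆ u), ((#(𝒮.filter (fun ρ => ρ ⊆ u)) : ℕ) : ZMod 2)
        = ∑ u ∈ 𝔊.filter (fun u => g ⊆ u), ∑ ρ ∈ 𝒮, (if ρ ⊆ u then (1 : ZMod 2) else 0) := by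
          refine Finset.sum_congr rfl fun u _ => ?_
          exact card_filter_cast 𝒮 (fun ρ => ρ ⊆ u)
      _ = ∑ u ∈ 𝔊, ∑ ρ ∈ 𝒮, (if g ∪ ρ ⊆ u then (1 : ZMod 2) else 0) := by
          rw [Finset.sum_filter]
          refine Finset.sum_congr rfl fun u _ => ?_
          by_cases hgu : g ⊆ u
          · rw [if_pos hgu]
            refine Finset.sum_congr rfl fun ρ _ => ?_
            by_cases hρu : ρ ⊆ u
            · rw [if_pos hρu, if_pos (Finset.union_subset hgu hρu)]
            · rw [if_neg hρu, if_neg (fun h => hρu (subset_union_right.trans h))]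
          · rw [if_neg hgu]
            symm
            refine Finset.sum_eq_zero fun ρ _ => ?_
            rw [if_neg (fun h => hgu (subset_union_left.trans h))]
      _ = ∑ ρ ∈ 𝒮, ∑ u ∈ 𝔊, (if g ∪ ρ ⊆ u then (1 : ZMod 2) else 0) := Finset.sum_comm
      _ = ∑ ρ ∈ 𝒮, ((#(𝔊.filter (fun u => g ∪ ρ ⊆ u)) : ℕ) : ZMod 2) := by
          refine Finset.sum_congr rfl fun ρ _ => ?_
          exact (card_filter_cast 𝔊 (fun u => g ∪ ρ ⊆ u)).symm
  -- each inner count is `[g ∪ ρ = univ] = [ρᶜ ⊆ g]`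
  have h3 : ∀ ρ ∈ 𝒮, ((#(𝔊.filter (fun u => g ∪ ρ ⊆ u)) : ℕ) : ZMod 2) =
      if ρᶜ ⊆ g then 1 else 0 := by
    intro ρ _
    rw [card_supersets_parity 𝔊 hG (g ∪ ρ) (hG g hg _ subset_union_left)]
    by_cases hc : ρᶜ ⊆ g
    · rw [if_pos hc, if_pos ((union_eq_univ_iff_compl_subset g ρ).2 hc)]
    · rw [if_neg hc, if_neg (fun h => hc ((union_eq_univ_iff_compl_subset g ρ).1 h))]
  rw [card_filter_cast, ← Finset.sum_congr rfl h3, ← h2, h1]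

/-- The flip lemma as an equivalence (apply it twice; `ρᶜᶜ = ρ`). [this work] -/
theorem flip_even_iff (𝔊 : Finset (Finset α))
    (hG : ∀ g ∈ 𝔊, ∀ g' : Finset α, g ⊆ g' → g' ∈ 𝔊)
    (𝒮 : Finset (Finset α)) :
    (∀ g ∈ 𝔊, ((#(𝒮.filter (fun ρ => ρ ⊆ g)) : ℕ) : ZMod 2) = 0) ↔
      (∀ g ∈ 𝔊, ((#(𝒮.filter (fun ρ => ρᶜ ⊆ g)) : ℕ) : ZMod 2) = 0) := by
  refine ⟨flip_even 𝔊 hG 𝒮, fun h => ?_⟩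
  -- apply the lemma to the complemented family
  have h' := flip_even 𝔊 hG (𝒮.image compl) ?_
  · intro g hg
    have := h' g hg
    rw [Finset.filter_image, Finset.card_image_of_injective _ compl_injective] at this
    simpa only [Function.comp_def, compl_compl] using this
  · intro g hg
    rw [Finset.filter_image, Finset.card_image_of_injective _ compl_injective]
    simpa only [Function.comp_def] using h g hg

/-- **All-L twin of an all-H independence statement** (the use made of the flip lemma in the memo): if the
only sub-family of `𝒯` whose members are evenly contained in every good is the empty one (the H-rows of `𝒯` are
GF(2)-independent), then the same holds for the complemented family (the L-rows of `𝒯` are independent).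
[this work] -/
theorem indep_compl_of_indep (𝔊 : Finset (Finset α))
    (hG : ∀ g ∈ 𝔊, ∀ g' : Finset α, g ⊆ g' → g' ∈ 𝔊)
    (𝒯 : Finset (Finset α))
    (hind : ∀ 𝒮 ⊆ 𝒯, (∀ g ∈ 𝔊, ((#(𝒮.filter (fun ρ => ρ ⊆ g)) : ℕ) : ZMod 2) = 0) → 𝒮 = ∅) :
    ∀ 𝒮 ⊆ 𝒯, (∀ g ∈ 𝔊, ((#(𝒮.filter (fun ρ => ρᶜ ⊆ g)) : ℕ) : ZMod 2) = 0) → 𝒮 = ∅ :=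
  fun 𝒮 h𝒮 h => hind 𝒮 h𝒮 ((flip_even_iff 𝔊 hG 𝒮).2 h)

end NineType

end Summit.CriticalPhenomena.PercolationContinuityZ3.Theorems
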